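import Mathlib.Analysis.SpecialFunctions.Pow.Integral      -- `integrableOn_ball_of_norm_le_rpow` (`‖W‖^{−k} ∈ L¹_loc(ℝ⁴)`, `k < 4`)
import Mathlib.Analysis.SpecialFunctions.Sqrt               -- `HasDerivAt.sqrt`
import Literature.Geometry.ComplexHyperbolic.UnitBallKCentralConeLimit   -- ★ the sheets `Q = −ε`, `finrank_real_fin_two_complex`
import HarnessLib

/-!
# Sheet integrals over `Q = −ε`: the majorants, uniformly in the blow-up parameter (ROAD A (A3-c) ENGINE, part 1: bounds)

Topic `Geometry/ComplexHyperbolic`; namespace `Literature.Geometry.ComplexHyperbolic.BallModel`.  THEOREMS ONLY (no `def`, no instance, no notation,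
no axiom, no named fact, no `sorry`).  Cell `pub/hodgecm-mathlib`, ENGINE T1 (crux H413 = `stmt-HodgeConjecture-24833`); floor-1½ preparation, count-neutral,
under row (S-d) ∕ «SdArch» ED. 3 node N1 = the (L_{U(2,1)}) letter ★ `ArchCentralLimitFormulaRankTwo` (`stub_ArchCentralLimitU21`): brick **ROAD A (A3-c) ENGINE, part 1**
(A-p14 (g28) cost census e5e8455f §3 + interface note (A2″); LEAD F0P3a-plan (g10) WORD T9-1 (4), 2026-09-01; author F0P3a-p05 (g13)).  Continues ★ `UnitBallHyperboloidChart`,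
★ `UnitBallKCentralConeLimit`; consumed by ★-to-be `UnitBallSheetIntegralDeriv` (part 2: the derivatives under the integral sign).

THE MATHEMATICS (Θ-free).  A SHEET DATUM is `Λ : ℂ² × ℝ → G`, `C²` in the real sheet coordinate `r` (`Λ′ = ∂_rΛ`, `Λ″ = ∂_r²Λ`, all three jointly continuous),
with an `r²`-SUPPORT BOUND `Λ(W, r) = 0` for `r² ≥ S` (for `Λ(W,r) = Θ(u•1 − η•N(W,r))` this is ★ `exists_radius_apply_add_eq_zero`).  Along the sheets,
`ρ := √(ε + |W|²)`, the `ε`-derivatives of `Λ(W, ρ)` are `(2ρ)⁻¹•Λ′(W,ρ)` and `(4ρ²)⁻¹•Λ″(W,ρ) − (4ρ³)⁻¹•Λ′(W,ρ)` (§2: `∂_ερ = (2ρ)⁻¹`, `∂_ε(2ρ)⁻¹ = −(4ρ³)⁻¹`).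
This file proves the three MAJORANTS, UNIFORM IN `ε ≥ 0`:
  `‖Λ(W,ρ)‖ ≤ C·𝟙{|W|²≤S}`,   `‖(2ρ)⁻¹•Λ′(W,ρ)‖ ≤ (B∕2)‖W‖⁻¹·𝟙{|W|²≤S}`,   `‖(4ρ²)⁻¹•Λ″ − (4ρ³)⁻¹•Λ′‖ ≤ D‖W‖⁻³·𝟙{|W|²≤S}`   (`W ≠ 0`)
— because `Λ′ = Λ″ = 0` past the support (derivatives of a locally vanishing function), `ρ ≥ ‖W‖_sup`, and `ρ, ‖W‖ ≤ √S` on the support — and that these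
majorants are INTEGRABLE on `ℂ² = ℝ⁴` (`‖W‖^{−k} ∈ L¹_loc` for `k < 4 = dim_ℝ ℂ²`, Mathlib `integrableOn_ball_of_norm_le_rpow`).

* §1 `ℂ² = ℝ⁴`: `norm_le_sqrt_nsq`, `isCompact_∕measurableSet_setOf_nsq_le`, `integrable_indicator_nsq_le_const`, **`integrable_indicator_nsq_le_mul_norm_rpow_neg`** (`k < 4`),
  `ae_ne_zero_volume_fin_two_complex`;
* §2 `ρ(ε) = √(ε+c)`: `hasDerivAt_sqrt_add_const`, `hasDerivAt_inv_two_mul_sqrt_add_const`, chain rules `hasDerivAt_comp_sqrt_add_const`,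
  **`hasDerivAt_inv_smul_comp_sqrt_add_const`** (the second `ε`-derivative along the sheet);
* §3 `deriv_eq_zero_of_lt_sq`, `deriv2_eq_zero_of_lt_sq`, `norm_le_sqrt_add_nsq`, **`exists_bound_sheet_zero ∕ one ∕ two`**.
HONEST LABEL: HC_CM is proved only modulo the printed citations until rung 0 closes; this file is real analysis over ★ ball-model files and pays nothing by itself.

## References
* [Rogawski1990] J. D. Rogawski, *Automorphic Representations of Unitary Groups in Three Variables*, Ann. of Math. Stud. 123 (1990), §8.4 pp. 126–127.
* [Rudin1980] W. Rudin, *Function Theory in the Unit Ball of ℂⁿ* (1980), §1.4 (integration on `ℂⁿ`; local integrability of `|z|^{−k}`, `k < 2n`).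
-/

noncomputable section

open MeasureTheory MeasureTheory.Measure Set Filter Topology Metric
open scoped ENNReal

namespace Literature.Geometry.ComplexHyperbolic.BallModel

/-! ### §1 `ℂ² = ℝ⁴`: sup norm versus Hermitian norm, the compact sets `{|W|² ≤ S}`, local integrability of `‖W‖^{−k}` (`k < 4`) -/

/-- `‖W‖_sup ≤ |W| = √(nsq W)`. [cite: Rudin1980, §1.4] -/
theorem norm_le_sqrt_nsq (W : Fin 2 → ℂ) : ‖W‖ ≤ Real.sqrt (nsq W) := by
  rw [pi_norm_le_iff_of_nonneg (Real.sqrt_nonneg _)]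
  intro i
  refine Real.le_sqrt_of_sq_le ?_
  have h0 : ‖W 0‖ ^ 2 ≤ nsq W := by unfold nsq; nlinarith [sq_nonneg ‖W 1‖]
  have h1 : ‖W 1‖ ^ 2 ≤ nsq W := by unfold nsq; nlinarith [sq_nonneg ‖W 0‖]
  fin_cases i
  · exact h0
  · exact h1

/-- `{W | nsq W ≤ M}` is compact. [cite: Rudin1980, §1.4] -/
theorem isCompact_setOf_nsq_le_ambient (M : ℝ) : IsCompact {W : Fin 2 → ℂ | nsq W ≤ M} := by
  refine Metric.isCompact_of_isClosed_isBounded (isClosed_le continuous_fun_nsq continuous_const) ?_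
  refine (Metric.isBounded_closedBall (x := (0 : Fin 2 → ℂ)) (r := Real.sqrt M)).subset fun W hW => ?_
  simp only [mem_setOf_eq] at hW
  rw [mem_closedBall_zero_iff]
  exact (norm_le_sqrt_nsq W).trans (Real.sqrt_le_sqrt hW)

/-- `{W | nsq W ≤ M}` is measurable. [cite: Rudin1980, §1.4] -/
theorem measurableSet_setOf_nsq_le (M : ℝ) : MeasurableSet {W : Fin 2 → ℂ | nsq W ≤ M} :=
  (isClosed_le continuous_fun_nsq continuous_const).measurableSet

/-- The constant majorant `𝟙{nsq ≤ M}·C` is integrable on `ℂ²`. [cite: Rudin1980, §1.4] -/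
theorem integrable_indicator_nsq_le_const (M C : ℝ) :
    Integrable (fun W : Fin 2 → ℂ => ({W : Fin 2 → ℂ | nsq W ≤ M}).indicator (fun _ => C) W) :=
  (integrable_indicator_iff (measurableSet_setOf_nsq_le M)).2 (integrableOn_const ((isCompact_setOf_nsq_le_ambient M).measure_lt_top.ne))

/-- **LOCAL INTEGRABILITY OF `‖W‖^{−k}` ON `ℂ² = ℝ⁴`**: `𝟙{nsq ≤ M}·c·‖W‖^{−k}` is integrable for `k < 4` (Mathlib `integrableOn_ball_of_norm_le_rpow`
with `finrank_ℝ ℂ² = 4`). [cite: Rudin1980, §1.4] -/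
theorem integrable_indicator_nsq_le_mul_norm_rpow_neg (M c : ℝ) {k : ℝ} (hk : k < 4) :
    Integrable (fun W : Fin 2 → ℂ => ({W : Fin 2 → ℂ | nsq W ≤ M}).indicator (fun W => c * ‖W‖ ^ (-k)) W) := by
  have hsub : {W : Fin 2 → ℂ | nsq W ≤ M} ⊆ ball (0 : Fin 2 → ℂ) (Real.sqrt M + 1) := fun W hW => by
    simp only [mem_setOf_eq] at hW
    rw [mem_ball_zero_iff]
    linarith [(norm_le_sqrt_nsq W).trans (Real.sqrt_le_sqrt hW)]
  have hsupp : Function.support (fun W : Fin 2 → ℂ => ({W : Fin 2 → ℂ | nsq W ≤ M}).indicator (fun W => c * ‖W‖ ^ (-k)) W) ⊆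
      ball (0 : Fin 2 → ℂ) (Real.sqrt M + 1) := support_indicator_subset.trans hsub
  rw [← integrableOn_iff_integrable_of_support_subset hsupp]
  refine integrableOn_ball_of_norm_le_rpow (μ := volume) (by rw [finrank_real_fin_two_complex]; norm_num) (C := |c|) (α := k)
    (by rw [finrank_real_fin_two_complex]; exact_mod_cast hk) (Filter.Eventually.of_forall fun W => ?_) ?_
  · by_cases hW : W ∈ {W : Fin 2 → ℂ | nsq W ≤ M}
    · rw [indicator_of_mem hW, Real.norm_eq_abs, abs_mul, abs_of_nonneg (Real.rpow_nonneg (norm_nonneg _) _)]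
    · rw [indicator_of_notMem hW, norm_zero]
      positivity
  · exact ((measurable_norm.pow_const _).const_mul _).aestronglyMeasurable.indicator (measurableSet_setOf_nsq_le M)

/-- For almost every `W ∈ ℂ²`, `W ≠ 0` (Lebesgue measure has no atoms). [cite: Rudin1980, §1.4] -/
theorem ae_ne_zero_volume_fin_two_complex : ∀ᵐ W : Fin 2 → ℂ, W ≠ 0 := by
  have h : ({0}ᶜ : Set (Fin 2 → ℂ)) ∈ ae (volume : Measure (Fin 2 → ℂ)) := compl_mem_ae_iff.2 (measure_singleton 0)
  exact Filter.mem_of_superset h fun W hW => hW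

/-! ### §2 One-variable calculus of the blow-up parameter: `ρ(ε) = √(ε + c)` -/

/-- `ε ↦ √(ε + c)` has derivative `(2√(ε+c))⁻¹` where `ε + c > 0`. [cite: Rudin1980, §1.4] -/
theorem hasDerivAt_sqrt_add_const {c ε : ℝ} (h : 0 < ε + c) :
    HasDerivAt (fun ε : ℝ => Real.sqrt (ε + c)) ((2 * Real.sqrt (ε + c))⁻¹) ε := by
  have h1 : HasDerivAt (fun ε : ℝ => ε + c) 1 ε := (hasDerivAt_id ε).add_const c
  convert h1.sqrt h.ne' using 1
  rw [one_div]

/-- `ε ↦ (2√(ε + c))⁻¹` has derivative `−(4 √(ε+c)³)⁻¹` where `ε + c > 0`. [cite: Rudin1980, §1.4] -/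
theorem hasDerivAt_inv_two_mul_sqrt_add_const {c ε : ℝ} (h : 0 < ε + c) :
    HasDerivAt (fun ε : ℝ => (2 * Real.sqrt (ε + c))⁻¹) (-(4 * Real.sqrt (ε + c) ^ 3)⁻¹) ε := by
  have hρ : 0 < Real.sqrt (ε + c) := Real.sqrt_pos.2 h
  have hρne : Real.sqrt (ε + c) ≠ 0 := hρ.ne'
  have h1 := ((hasDerivAt_sqrt_add_const h).const_mul 2).inv (by positivity)
  refine h1.congr_deriv ?_
  field_simp
  ring

/-- CHAIN RULE on the sheet: if `f` has derivative `f′` everywhere then `ε ↦ f(√(ε+c))` has derivative `(2√(ε+c))⁻¹ • f′(√(ε+c))` (`ε + c > 0`).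
[cite: Rudin1980, §1.4] -/
theorem hasDerivAt_comp_sqrt_add_const {G : Type*} [NormedAddCommGroup G] [NormedSpace ℝ G] {f f' : ℝ → G}
    (hf : ∀ r, HasDerivAt f (f' r) r) {c ε : ℝ} (h : 0 < ε + c) :
    HasDerivAt (fun ε : ℝ => f (Real.sqrt (ε + c))) ((2 * Real.sqrt (ε + c))⁻¹ • f' (Real.sqrt (ε + c))) ε :=
  (hf _).scomp ε (hasDerivAt_sqrt_add_const h)

/-- SECOND DERIVATIVE on the sheet: with `f′`, `f″` the first two derivatives of `f`,
`ε ↦ (2√(ε+c))⁻¹ • f′(√(ε+c))` has derivative `(4(ε+c))⁻¹ • f″(√(ε+c)) − (4√(ε+c)³)⁻¹ • f′(√(ε+c))` (`ε + c > 0`). [cite: Rudin1980, §1.4] -/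
theorem hasDerivAt_inv_smul_comp_sqrt_add_const {G : Type*} [NormedAddCommGroup G] [NormedSpace ℝ G] {f' f'' : ℝ → G}
    (hf' : ∀ r, HasDerivAt f' (f'' r) r) {c ε : ℝ} (h : 0 < ε + c) :
    HasDerivAt (fun ε : ℝ => (2 * Real.sqrt (ε + c))⁻¹ • f' (Real.sqrt (ε + c)))
      ((4 * Real.sqrt (ε + c) ^ 2)⁻¹ • f'' (Real.sqrt (ε + c)) - (4 * Real.sqrt (ε + c) ^ 3)⁻¹ • f' (Real.sqrt (ε + c))) ε := by
  have hρ : 0 < Real.sqrt (ε + c) := Real.sqrt_pos.2 h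
  have h1 := (hasDerivAt_inv_two_mul_sqrt_add_const h).smul (hasDerivAt_comp_sqrt_add_const hf' h)
  refine h1.congr_deriv ?_
  rw [smul_smul, neg_smul, ← sub_eq_add_neg]
  congr 2
  field_simp
  ring

/-! ### §3 The engine: a family `Λ(W, r)` that is `C²` in the real sheet coordinate `r` with `r²`-support bound

Throughout, `Λ Λ′ Λ″ : ℂ² → ℝ → G` are jointly continuous, `∂_r Λ = Λ′`, `∂_r Λ′ = Λ″`, and `Λ(W, r) = 0` whenever `r² ≥ S`.  The sheet integrals are
`I(ε) = ∫ Λ(W, √(ε+|W|²)) d⁴W`, `I₁(ε) = ∫ (2ρ)⁻¹•Λ′(W, ρ) d⁴W`, `I₂(ε) = ∫ [(4ρ²)⁻¹•Λ″(W,ρ) − (4ρ³)⁻¹•Λ′(W,ρ)] d⁴W`, `ρ = √(ε + |W|²)`. -/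

section Engine

variable {G : Type*} [NormedAddCommGroup G] [NormedSpace ℝ G] {Λ Λ' Λ'' : (Fin 2 → ℂ) → ℝ → G} {S : ℝ}

/-- The derivative data vanish where `Λ` does: `Λ′(W, r) = 0` for `r² > S`. [cite: Rudin1980, §1.4] -/
theorem deriv_eq_zero_of_lt_sq (hd : ∀ W r, HasDerivAt (Λ W) (Λ' W r) r) (hS : ∀ W r, S ≤ r ^ 2 → Λ W r = 0)
    (W : Fin 2 → ℂ) {r : ℝ} (hr : S < r ^ 2) : Λ' W r = 0 := by
  have hev : (Λ W) =ᶠ[𝓝 r] fun _ => (0 : G) := by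
    filter_upwards [(isOpen_lt continuous_const (continuous_pow 2)).mem_nhds hr] with r' hr'
    exact hS W r' (le_of_lt hr')
  exact (hd W r).unique ((hasDerivAt_const r (0 : G)).congr_of_eventuallyEq hev)

/-- … and `Λ″(W, r) = 0` for `r² > S`. [cite: Rudin1980, §1.4] -/
theorem deriv2_eq_zero_of_lt_sq (hd : ∀ W r, HasDerivAt (Λ W) (Λ' W r) r) (hd' : ∀ W r, HasDerivAt (Λ' W) (Λ'' W r) r)
    (hS : ∀ W r, S ≤ r ^ 2 → Λ W r = 0) (W : Fin 2 → ℂ) {r : ℝ} (hr : S < r ^ 2) : Λ'' W r = 0 := by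
  have hev : (Λ' W) =ᶠ[𝓝 r] fun _ => (0 : G) := by
    filter_upwards [(isOpen_lt continuous_const (continuous_pow 2)).mem_nhds hr] with r' hr'
    exact deriv_eq_zero_of_lt_sq hd hS W hr'
  exact (hd' W r).unique ((hasDerivAt_const r (0 : G)).congr_of_eventuallyEq hev)

/-- The sheet coordinate dominates the sup norm: `‖W‖ ≤ √(ε + nsq W)` for `ε ≥ 0`. [cite: Rudin1980, §1.4] -/
theorem norm_le_sqrt_add_nsq (W : Fin 2 → ℂ) {ε : ℝ} (hε : 0 ≤ ε) : ‖W‖ ≤ Real.sqrt (ε + nsq W) :=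
  (norm_le_sqrt_nsq W).trans (Real.sqrt_le_sqrt (by linarith))

omit [NormedSpace ℝ G] in
/-- UNIFORM BOUND, ORDER 0: a jointly continuous `Λ` with `r²`-support bound `S` satisfies `‖Λ(W, √(ε+|W|²))‖ ≤ C·𝟙{nsq ≤ S}(W)` for all `ε ≥ 0`, `W`.
[cite: Rudin1980, §1.4] -/
theorem exists_bound_sheet_zero (hΛ : Continuous (Function.uncurry Λ)) (hS : ∀ W r, S ≤ r ^ 2 → Λ W r = 0) :
    ∃ C : ℝ, 0 ≤ C ∧ ∀ ε : ℝ, 0 ≤ ε → ∀ W : Fin 2 → ℂ,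
      ‖Λ W (Real.sqrt (ε + nsq W))‖ ≤ ({W : Fin 2 → ℂ | nsq W ≤ S}).indicator (fun _ => C) W := by
  obtain ⟨C, hC⟩ := ((isCompact_setOf_nsq_le_ambient S).prod (isCompact_Icc (a := (0 : ℝ)) (b := Real.sqrt S))).exists_bound_of_continuousOn
    hΛ.norm.continuousOn
  refine ⟨max C 0, le_max_right _ _, fun ε hε W => ?_⟩
  by_cases hW : W ∈ {W : Fin 2 → ℂ | nsq W ≤ S}
  · rw [indicator_of_mem hW]
    by_cases hr : S < Real.sqrt (ε + nsq W) ^ 2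
    · rw [hS W _ hr.le, norm_zero]
      exact le_max_right _ _
    · have hmem : (W, Real.sqrt (ε + nsq W)) ∈ {W : Fin 2 → ℂ | nsq W ≤ S} ×ˢ Icc (0 : ℝ) (Real.sqrt S) :=
        ⟨hW, Real.sqrt_nonneg _, Real.le_sqrt_of_sq_le (not_lt.1 hr)⟩
      have h := hC _ hmem
      rw [norm_norm] at h
      exact h.trans (le_max_left _ _)
  · rw [indicator_of_notMem hW]
    simp only [mem_setOf_eq, not_le] at hW
    have hr : S ≤ Real.sqrt (ε + nsq W) ^ 2 := by
      rw [Real.sq_sqrt (by linarith [nsq_nonneg W])]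
      linarith
    rw [hS W _ hr, norm_zero]

/-- UNIFORM BOUND, ORDER 1: `‖(2ρ)⁻¹ • Λ′(W, ρ)‖ ≤ (B∕2)·‖W‖⁻¹·𝟙{nsq ≤ S}(W)` for `ε ≥ 0` and `W ≠ 0` (`ρ = √(ε+|W|²) ≥ ‖W‖`). [cite: Rudin1980, §1.4] -/
theorem exists_bound_sheet_one (hΛ' : Continuous (Function.uncurry Λ')) (hd : ∀ W r, HasDerivAt (Λ W) (Λ' W r) r)
    (hS : ∀ W r, S ≤ r ^ 2 → Λ W r = 0) :
    ∃ B : ℝ, 0 ≤ B ∧ ∀ ε : ℝ, 0 ≤ ε → ∀ W : Fin 2 → ℂ, W ≠ 0 →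
      ‖(2 * Real.sqrt (ε + nsq W))⁻¹ • Λ' W (Real.sqrt (ε + nsq W))‖ ≤
        ({W : Fin 2 → ℂ | nsq W ≤ S}).indicator (fun W => B / 2 * ‖W‖ ^ (-(1 : ℝ))) W := by
  obtain ⟨B, hB⟩ := ((isCompact_setOf_nsq_le_ambient S).prod (isCompact_Icc (a := (0 : ℝ)) (b := Real.sqrt S))).exists_bound_of_continuousOn
    hΛ'.norm.continuousOn
  refine ⟨max B 0, le_max_right _ _, fun ε hε W hW0 => ?_⟩
  have hn : 0 < ‖W‖ := norm_pos_iff.2 hW0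
  have hρ : ‖W‖ ≤ Real.sqrt (ε + nsq W) := norm_le_sqrt_add_nsq W hε
  have hρ0 : 0 < Real.sqrt (ε + nsq W) := hn.trans_le hρ
  by_cases hW : W ∈ {W : Fin 2 → ℂ | nsq W ≤ S}
  · rw [indicator_of_mem hW, Real.rpow_neg (norm_nonneg _), Real.rpow_one, norm_smul, norm_inv, Real.norm_of_nonneg (by positivity)]
    by_cases hr : S < Real.sqrt (ε + nsq W) ^ 2
    · rw [deriv_eq_zero_of_lt_sq hd hS W hr, norm_zero, mul_zero]
      positivity
    · have hmem : (W, Real.sqrt (ε + nsq W)) ∈ {W : Fin 2 → ℂ | nsq W ≤ S} ×ˢ Icc (0 : ℝ) (Real.sqrt S) :=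
        ⟨hW, Real.sqrt_nonneg _, Real.le_sqrt_of_sq_le (not_lt.1 hr)⟩
      have h := hB _ hmem
      rw [norm_norm] at h
      calc (2 * Real.sqrt (ε + nsq W))⁻¹ * ‖Λ' W (Real.sqrt (ε + nsq W))‖
          ≤ (2 * ‖W‖)⁻¹ * max B 0 := by
            gcongr
            · exact h.trans (le_max_left _ _)
        _ = max B 0 / 2 * ‖W‖⁻¹ := by field_simp
  · rw [indicator_of_notMem hW]
    simp only [mem_setOf_eq, not_le] at hW
    have hr : S < Real.sqrt (ε + nsq W) ^ 2 := by
      rw [Real.sq_sqrt (by linarith [nsq_nonneg W])]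
      linarith
    rw [deriv_eq_zero_of_lt_sq hd hS W hr, smul_zero, norm_zero]

/-- UNIFORM BOUND, ORDER 2: `‖(4ρ²)⁻¹ • Λ″(W,ρ) − (4ρ³)⁻¹ • Λ′(W,ρ)‖ ≤ D·‖W‖⁻³·𝟙{nsq ≤ S}(W)` for `ε ≥ 0`, `W ≠ 0`. [cite: Rudin1980, §1.4] -/
theorem exists_bound_sheet_two (hΛ' : Continuous (Function.uncurry Λ')) (hΛ'' : Continuous (Function.uncurry Λ''))
    (hd : ∀ W r, HasDerivAt (Λ W) (Λ' W r) r) (hd' : ∀ W r, HasDerivAt (Λ' W) (Λ'' W r) r) (hS : ∀ W r, S ≤ r ^ 2 → Λ W r = 0) :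
    ∃ D : ℝ, 0 ≤ D ∧ ∀ ε : ℝ, 0 ≤ ε → ∀ W : Fin 2 → ℂ, W ≠ 0 →
      ‖(4 * Real.sqrt (ε + nsq W) ^ 2)⁻¹ • Λ'' W (Real.sqrt (ε + nsq W)) - (4 * Real.sqrt (ε + nsq W) ^ 3)⁻¹ • Λ' W (Real.sqrt (ε + nsq W))‖ ≤
        ({W : Fin 2 → ℂ | nsq W ≤ S}).indicator (fun W => D * ‖W‖ ^ (-(3 : ℝ))) W := by
  obtain ⟨A, hA⟩ := ((isCompact_setOf_nsq_le_ambient S).prod (isCompact_Icc (a := (0 : ℝ)) (b := Real.sqrt S))).exists_bound_of_continuousOn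
    hΛ''.norm.continuousOn
  obtain ⟨B, hB⟩ := ((isCompact_setOf_nsq_le_ambient S).prod (isCompact_Icc (a := (0 : ℝ)) (b := Real.sqrt S))).exists_bound_of_continuousOn
    hΛ'.norm.continuousOn
  refine ⟨(max A 0 * Real.sqrt S + max B 0) / 4, by positivity, fun ε hε W hW0 => ?_⟩
  have hn : 0 < ‖W‖ := norm_pos_iff.2 hW0
  have hρ : ‖W‖ ≤ Real.sqrt (ε + nsq W) := norm_le_sqrt_add_nsq W hε
  have hρ0 : 0 < Real.sqrt (ε + nsq W) := hn.trans_le hρ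
  by_cases hW : W ∈ {W : Fin 2 → ℂ | nsq W ≤ S}
  · have hWS : ‖W‖ ≤ Real.sqrt S := (norm_le_sqrt_nsq W).trans (Real.sqrt_le_sqrt hW)
    rw [indicator_of_mem hW, Real.rpow_neg (norm_nonneg _), show (3 : ℝ) = ((3 : ℕ) : ℝ) by norm_num, Real.rpow_natCast]
    by_cases hr : S < Real.sqrt (ε + nsq W) ^ 2
    · rw [deriv_eq_zero_of_lt_sq hd hS W hr, deriv2_eq_zero_of_lt_sq hd hd' hS W hr, smul_zero, smul_zero, sub_zero, norm_zero]
      positivity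
    · have hmem : (W, Real.sqrt (ε + nsq W)) ∈ {W : Fin 2 → ℂ | nsq W ≤ S} ×ˢ Icc (0 : ℝ) (Real.sqrt S) :=
        ⟨hW, Real.sqrt_nonneg _, Real.le_sqrt_of_sq_le (not_lt.1 hr)⟩
      have hA' : ‖Λ'' W (Real.sqrt (ε + nsq W))‖ ≤ max A 0 := by
        have h := hA _ hmem; rw [norm_norm] at h; exact h.trans (le_max_left _ _)
      have hB' : ‖Λ' W (Real.sqrt (ε + nsq W))‖ ≤ max B 0 := by
        have h := hB _ hmem; rw [norm_norm] at h; exact h.trans (le_max_left _ _)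
      set ρ := Real.sqrt (ε + nsq W) with hρdef
      calc ‖(4 * ρ ^ 2)⁻¹ • Λ'' W ρ - (4 * ρ ^ 3)⁻¹ • Λ' W ρ‖
          ≤ ‖(4 * ρ ^ 2)⁻¹ • Λ'' W ρ‖ + ‖(4 * ρ ^ 3)⁻¹ • Λ' W ρ‖ := norm_sub_le _ _
        _ = (4 * ρ ^ 2)⁻¹ * ‖Λ'' W ρ‖ + (4 * ρ ^ 3)⁻¹ * ‖Λ' W ρ‖ := by
            rw [norm_smul, norm_smul, norm_inv, norm_inv, Real.norm_of_nonneg (by positivity), Real.norm_of_nonneg (by positivity)]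
        _ ≤ (4 * ‖W‖ ^ 2)⁻¹ * max A 0 + (4 * ‖W‖ ^ 3)⁻¹ * max B 0 := by gcongr
        _ = (max A 0 * ‖W‖ + max B 0) / 4 * (‖W‖ ^ 3)⁻¹ := by field_simp
        _ ≤ (max A 0 * Real.sqrt S + max B 0) / 4 * (‖W‖ ^ 3)⁻¹ := by gcongr
  · rw [indicator_of_notMem hW]
    simp only [mem_setOf_eq, not_le] at hW
    have hr : S < Real.sqrt (ε + nsq W) ^ 2 := by
      rw [Real.sq_sqrt (by linarith [nsq_nonneg W])]
      linarith
    rw [deriv_eq_zero_of_lt_sq hd hS W hr, deriv2_eq_zero_of_lt_sq hd hd' hS W hr, smul_zero, smul_zero, sub_zero, norm_zero]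

end Engine

end Literature.Geometry.ComplexHyperbolic.BallModel

end
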